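import Summits.ResolutionOfSingularities.ResolutionOfSingularities.Theorems.FrobeniusClosingPatchingRelPerfectMonomialPolyhedraGameFree
import HarnessLib

/-!
# Crux `PatchingRelPerfect` (stmt-ResolutionOfSingularities-16161), chain w52 — TargetsF3 (m) «M2-strong»,
# COMBINATORIAL HALF, Route F file F3: the Z-CLASS of a stratum and its DEFECT

[OURS · L1 W5.2 · background line; res-L1-w52-stub-4 g3 ROUTE-F memo §0 (G2)(G3) and §2(c), kernel form;
fact-free; nothing here is a statement of the manuscript under review]

For a state `s`, a set `F` of (free) indices and a stratum `T`, the Z-CLASS `Z s F T` is the set of generators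
that are least on the `F`-free part `T \\ F` (non-empty iff the state is principal there — automatic in the free
game); its members agree on `T \\ F` and every other generator has strictly larger weight there
(`weight_lt_of_not_mem_Z`).  A Z-LEAST member (`IsZLeast`: least among `Z` on `T ∩ F`) exists as soon as the
Z-members are pairwise comparable on `T ∩ F`, and then **the state is principal at `T` iff the DEFECT
`defect s F T ζ = Σ_{α ∉ Z} Σ_{g ∈ T ∩ F} (ζ g − α g)⁺` vanishes** (`principalAt_iff_defect_eq_zero`).
The MIXED CHART computation of ROUTE-F §2(c): blowing up `J = (T \\ F) ∪ {f}` (`f ∈ T ∩ F`) and passing to the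
`f`-chart `insert N (T.erase f)` keeps the Z-class (as an image), keeps Z-leastness, and does not increase the
defect — strictly decreases it when `ζ f > α f` for some generator `α ∉ Z` (`defect_chart_le`, `defect_chart_lt`).

## References

* J. Kollár, *Lectures on Resolution of Singularities* (2007), (3.111) Step 3. [Kollar2007]
-/

-- `Summit.<Summit>.<Sub>.Theorems` with `Sub = Summit` (single-conjunct summit, D-0017)
set_option linter.dupNamespace false

namespace Summit.ResolutionOfSingularities.ResolutionOfSingularities.Theorems

namespace PolyhedraGame

open Finset

/-! ## The Z-class -/

section ZClass

variable (s : State) (F : Finset ℕ)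

/-- [OURS · W5.2 Route F] The Z-CLASS of `T`: the generators that are least on the `F`-free part `T \ F`. -/
noncomputable def Z (T : Finset ℕ) : Finset (ℕ →₀ ℕ) := by
  classical exact s.A.filter fun α => ∀ β ∈ s.A, ∀ i ∈ T \ F, α i ≤ β i

variable {s F}

/-- [OURS] Membership in the Z-class. -/
theorem mem_Z_iff {T : Finset ℕ} {α : ℕ →₀ ℕ} :
    α ∈ Z s F T ↔ α ∈ s.A ∧ ∀ β ∈ s.A, ∀ i ∈ T \ F, α i ≤ β i := by
  classical
  simp only [Z, Finset.mem_filter]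

/-- [OURS] The Z-class only depends on the `F`-free part of `T`. -/
theorem Z_congr {T T' : Finset ℕ} (h : T \ F = T' \ F) : Z s F T = Z s F T' := by
  ext α; rw [mem_Z_iff, mem_Z_iff, h]

/-- [OURS] Z-members are generators. -/
theorem mem_A_of_mem_Z {T : Finset ℕ} {α : ℕ →₀ ℕ} (h : α ∈ Z s F T) : α ∈ s.A := (mem_Z_iff.mp h).1

/-- [OURS] **The Z-class is non-empty iff the state is principal at the `F`-free part** (so always, in the
free game, for a stratum `T`). -/
theorem Z_nonempty_iff {T : Finset ℕ} : (Z s F T).Nonempty ↔ PrincipalAt s (T \ F) := by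
  constructor
  · rintro ⟨α, hα⟩
    obtain ⟨hαA, hmin⟩ := mem_Z_iff.mp hα
    exact ⟨α, hαA, hmin⟩
  · rintro ⟨α, hαA, hmin⟩
    exact ⟨α, mem_Z_iff.mpr ⟨hαA, hmin⟩⟩

/-- [OURS] Z-members agree on the `F`-free part. -/
theorem Z_apply_eq {T : Finset ℕ} {μ μ' : ℕ →₀ ℕ} (hμ : μ ∈ Z s F T) (hμ' : μ' ∈ Z s F T) {i : ℕ}
    (hi : i ∈ T \ F) : μ i = μ' i :=
  le_antisymm ((mem_Z_iff.mp hμ).2 μ' (mem_A_of_mem_Z hμ') i hi) ((mem_Z_iff.mp hμ').2 μ (mem_A_of_mem_Z hμ) i hi)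

/-- [OURS] Z-members have the same weight on the `F`-free part. -/
theorem weight_eq_of_mem_Z {T : Finset ℕ} {μ μ' : ℕ →₀ ℕ} (hμ : μ ∈ Z s F T) (hμ' : μ' ∈ Z s F T) :
    weight (T \ F) μ = weight (T \ F) μ' :=
  Finset.sum_congr rfl fun _ hi => Z_apply_eq hμ hμ' hi

/-- [OURS] A Z-member is pointwise below every generator on the `F`-free part. -/
theorem le_of_mem_Z {T : Finset ℕ} {μ α : ℕ →₀ ℕ} (hμ : μ ∈ Z s F T) (hα : α ∈ s.A) {i : ℕ} (hi : i ∈ T \ F) :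
    μ i ≤ α i :=
  (mem_Z_iff.mp hμ).2 α hα i hi

/-- [OURS] **A generator outside the Z-class has strictly larger weight on the `F`-free part** than any
Z-member. -/
theorem weight_lt_of_not_mem_Z {T : Finset ℕ} {μ α : ℕ →₀ ℕ} (hμ : μ ∈ Z s F T) (hα : α ∈ s.A)
    (hαZ : α ∉ Z s F T) : weight (T \ F) μ < weight (T \ F) α := by
  -- some index of `T \ F` where `α` is strictly above `μ`
  obtain ⟨i, hi, hlt⟩ : ∃ i ∈ T \ F, μ i < α i := by
    by_contra h
    push Not at h
    refine hαZ (mem_Z_iff.mpr ⟨hα, fun β hβ j hj => ?_⟩)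
    exact (h j hj).trans (le_of_mem_Z hμ hβ hj)
  exact Finset.sum_lt_sum (fun j hj => le_of_mem_Z hμ hα hj) ⟨i, hi, hlt⟩

end ZClass

/-! ## Z-least members and the defect -/

section Defect

variable (s : State) (F : Finset ℕ)

/-- [OURS · W5.2 Route F] `ζ` is Z-LEAST at `T`: a Z-member that is least among the Z-members on `T ∩ F` (hence on
all of `T`). -/
def IsZLeast (T : Finset ℕ) (ζ : ℕ →₀ ℕ) : Prop :=
  ζ ∈ Z s F T ∧ ∀ μ ∈ Z s F T, ∀ g ∈ T ∩ F, ζ g ≤ μ g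

/-- [OURS · W5.2 Route F] The DEFECT of `T` with respect to `ζ`: the total amount by which `ζ` fails to be below
the non-Z generators on the free indices of `T` (truncated differences). -/
noncomputable def defect (T : Finset ℕ) (ζ : ℕ →₀ ℕ) : ℕ :=
  ∑ α ∈ s.A \ Z s F T, ∑ g ∈ T ∩ F, (ζ g - α g)

variable {s F}

/-- [OURS] A Z-least member is below every Z-member on all of `T`. -/
theorem IsZLeast.le_of_mem_Z {T : Finset ℕ} {ζ μ : ℕ →₀ ℕ} (hζ : IsZLeast s F T ζ) (hμ : μ ∈ Z s F T)
    {i : ℕ} (hi : i ∈ T) : ζ i ≤ μ i := by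
  by_cases hiF : i ∈ F
  · exact hζ.2 μ hμ i (Finset.mem_inter.mpr ⟨hi, hiF⟩)
  · exact (Z_apply_eq hζ.1 hμ (Finset.mem_sdiff.mpr ⟨hi, hiF⟩)).le

/-- [OURS] **A Z-least member exists when the Z-class is non-empty and its members are pairwise comparable on
`T ∩ F`.** -/
theorem exists_isZLeast {T : Finset ℕ} (hne : (Z s F T).Nonempty)
    (hcomp : ∀ μ ∈ Z s F T, ∀ μ' ∈ Z s F T, (∀ g ∈ T ∩ F, μ g ≤ μ' g) ∨ (∀ g ∈ T ∩ F, μ' g ≤ μ g)) :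
    ∃ ζ, IsZLeast s F T ζ := by
  classical
  suffices key : ∀ A' : Finset (ℕ →₀ ℕ), A' ⊆ Z s F T → A'.Nonempty →
      ∃ ζ ∈ A', ∀ μ ∈ A', ∀ g ∈ T ∩ F, ζ g ≤ μ g by
    obtain ⟨ζ, hζ, hmin⟩ := key _ le_rfl hne
    exact ⟨ζ, hζ, hmin⟩
  intro A'
  induction A' using Finset.induction_on with
  | empty => intro _ h; exact absurd h Finset.not_nonempty_empty
  | @insert γ A' _ ih =>
    intro hsub _
    by_cases hA' : A'.Nonempty
    · obtain ⟨ζ, hζ, hmin⟩ := ih ((Finset.subset_insert _ _).trans hsub) hA'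
      rcases hcomp γ (hsub (Finset.mem_insert_self _ _)) ζ (hsub (Finset.mem_insert_of_mem hζ)) with hle | hle
      · refine ⟨γ, Finset.mem_insert_self _ _, fun μ hμ g hg => ?_⟩
        rcases Finset.mem_insert.mp hμ with rfl | hμ
        · exact le_rfl
        · exact (hle g hg).trans (hmin μ hμ g hg)
      · refine ⟨ζ, Finset.mem_insert_of_mem hζ, fun μ hμ g hg => ?_⟩
        rcases Finset.mem_insert.mp hμ with rfl | hμ
        · exact hle g hg
        · exact hmin μ hμ g hg
    · rw [Finset.not_nonempty_iff_eq_empty] at hA'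
      subst hA'
      refine ⟨γ, Finset.mem_insert_self _ _, fun μ hμ g _ => ?_⟩
      rw [Finset.insert_empty, Finset.mem_singleton] at hμ
      rw [hμ]

/-- [OURS] **Principality at `T` is the vanishing of the defect** (for a Z-least `ζ`). -/
theorem principalAt_iff_defect_eq_zero {T : Finset ℕ} {ζ : ℕ →₀ ℕ} (hζ : IsZLeast s F T ζ) :
    PrincipalAt s T ↔ defect s F T ζ = 0 := by
  constructor
  · rintro ⟨l₀, hl₀A, hmin⟩
    -- the least element is a Z-member and agrees with `ζ` on `T ∩ F`
    have hl₀Z : l₀ ∈ Z s F T :=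
      mem_Z_iff.mpr ⟨hl₀A, fun β hβ i hi => hmin β hβ i (Finset.mem_sdiff.mp hi).1⟩
    refine Finset.sum_eq_zero fun α hα => Finset.sum_eq_zero fun g hg => ?_
    have h1 : ζ g ≤ l₀ g := hζ.2 l₀ hl₀Z g hg
    have h2 : l₀ g ≤ α g := hmin α (Finset.mem_sdiff.mp hα).1 g (Finset.mem_inter.mp hg).1
    exact Nat.sub_eq_zero_of_le (h1.trans h2)
  · intro h0
    refine ⟨ζ, mem_A_of_mem_Z hζ.1, fun α hα i hi => ?_⟩
    by_cases hαZ : α ∈ Z s F T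
    · exact hζ.le_of_mem_Z hαZ hi
    · by_cases hiF : i ∈ F
      · have hig : i ∈ T ∩ F := Finset.mem_inter.mpr ⟨hi, hiF⟩
        have := Finset.sum_eq_zero_iff.mp h0 α (Finset.mem_sdiff.mpr ⟨hα, hαZ⟩)
        have := Finset.sum_eq_zero_iff.mp this i hig
        omega
      · exact le_of_mem_Z hζ.1 hα (Finset.mem_sdiff.mpr ⟨hi, hiF⟩)

/-- [OURS] **At a non-principal stratum the Z-least member is beaten at some free index by some non-Z
generator** (the choice made by Phase B of ROUTE-F). -/
theorem exists_violation_of_not_principalAt {T : Finset ℕ} {ζ : ℕ →₀ ℕ} (hζ : IsZLeast s F T ζ)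
    (hnp : ¬ PrincipalAt s T) : ∃ α ∈ s.A, α ∉ Z s F T ∧ ∃ f ∈ T ∩ F, α f < ζ f := by
  rw [principalAt_iff_defect_eq_zero hζ] at hnp
  obtain ⟨α, hα, hne⟩ := Finset.exists_ne_zero_of_sum_ne_zero hnp
  obtain ⟨f, hf, hne'⟩ := Finset.exists_ne_zero_of_sum_ne_zero hne
  rw [Finset.mem_sdiff] at hα
  exact ⟨α, hα.1, hα.2, f, hf, by omega⟩

end Defect

/-! ## The mixed chart: blowing up `J = (T \ F) ∪ {f}` and passing to the `f`-chart -/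

section MixedChart

variable {s : State} {F : Finset ℕ} {T : Finset ℕ} {f N : ℕ}

/-- [OURS] The `F`-free part of the `f`-chart `insert N (T.erase f)` (new free index `N`) is that of `T`. -/
theorem chart_sdiff_eq (hf : f ∈ F) (hNT : N ∉ T) :
    insert N (T.erase f) \ insert N F = T \ F := by
  ext i
  simp only [Finset.mem_sdiff, Finset.mem_insert, Finset.mem_erase, not_or]
  constructor
  · rintro ⟨h1 | ⟨_, h1⟩, h2, h3⟩
    · exact absurd h1 h2
    · exact ⟨h1, h3⟩
  · rintro ⟨h1, h2⟩
    exact ⟨Or.inr ⟨fun h => h2 (h ▸ hf), h1⟩, fun h => hNT (h ▸ h1), h2⟩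

/-- [OURS] The free part of the `f`-chart: `(T ∩ F).erase f` together with `N`. -/
theorem chart_inter_eq :
    insert N (T.erase f) ∩ insert N F = insert N ((T ∩ F).erase f) := by
  ext i
  simp only [Finset.mem_inter, Finset.mem_insert, Finset.mem_erase]
  constructor
  · rintro ⟨h1 | ⟨h1, h2⟩, h3 | h3⟩
    · exact Or.inl h1
    · exact Or.inl h1
    · exact Or.inl h3
    · exact Or.inr ⟨h1, h2, h3⟩
  · rintro (h1 | ⟨h1, h2, h3⟩)
    · exact ⟨Or.inl h1, Or.inl h1⟩
    · exact ⟨Or.inr ⟨h1, h2⟩, Or.inr h3⟩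

/-- [OURS] The moved vector at an old index. -/
theorem moveExp_apply_old (hN : N ∉ s.B) {J : Finset ℕ} {c : ℕ} {α : ℕ →₀ ℕ} {i : ℕ} (hi : i ∈ s.B) :
    moveExp J N c α i = α i :=
  moveExp_apply_of_ne α fun h => hN (h ▸ hi)

/-- [OURS] The moved vector of a generator at the exceptional index (total transform). -/
theorem moveExp_apply_new (hs : s.WF) (hN : N ∉ s.B) {J : Finset ℕ} {α : ℕ →₀ ℕ} (hα : α ∈ s.A) :
    moveExp J N 0 α N = weight J α := by
  rw [moveExp_apply_self α fun h => hN (hs.support_subset α hα h), Nat.sub_zero]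

/-- [OURS] `moveExp` is injective on the generators (the exceptional index is outside their supports). -/
theorem moveExp_injOn (hs : s.WF) (hN : N ∉ s.B) {J : Finset ℕ} {c : ℕ} : Set.InjOn (moveExp J N c) s.A := by
  intro α hα β hβ h
  ext i
  by_cases hi : i = N
  · subst hi
    have hα0 : α i = 0 := Finsupp.notMem_support_iff.mp fun h' => hN (hs.support_subset α hα h')
    have hβ0 : β i = 0 := Finsupp.notMem_support_iff.mp fun h' => hN (hs.support_subset β hβ h')
    rw [hα0, hβ0]
  · have := congrArg (fun γ => γ i) h
    simpa [moveExp_apply_of_ne _ hi] using this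

/-- [OURS] **The Z-class of the `f`-chart is the image of the Z-class** (the `F`-free part is unchanged and the
generators' values there are unchanged). -/
theorem Z_chart (hN : N ∉ s.B) (hf : f ∈ F) (hT : T ⊆ s.B) {J : Finset ℕ} :
    Z (move s J N 0) (insert N F) (insert N (T.erase f)) = (Z s F T).image (moveExp J N 0) := by
  classical
  have hNT : N ∉ T := fun h => hN (hT h)
  have hsd := chart_sdiff_eq (T := T) hf hNT
  ext α'
  rw [mem_Z_iff, hsd, Finset.mem_image]
  constructor
  · rintro ⟨hα', hmin⟩
    obtain ⟨α, hα, rfl⟩ := Finset.mem_image.mp hα'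
    refine ⟨α, mem_Z_iff.mpr ⟨hα, fun β hβ i hi => ?_⟩, rfl⟩
    have hiB : i ∈ s.B := hT (Finset.mem_sdiff.mp hi).1
    have := hmin (moveExp J N 0 β) (Finset.mem_image_of_mem _ hβ) i hi
    rwa [moveExp_apply_old hN hiB, moveExp_apply_old hN hiB] at this
  · rintro ⟨α, hα, rfl⟩
    obtain ⟨hαA, hmin⟩ := mem_Z_iff.mp hα
    refine ⟨Finset.mem_image_of_mem _ hαA, fun β' hβ' i hi => ?_⟩
    obtain ⟨β, hβ, rfl⟩ := Finset.mem_image.mp hβ'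
    have hiB : i ∈ s.B := hT (Finset.mem_sdiff.mp hi).1
    rw [moveExp_apply_old hN hiB, moveExp_apply_old hN hiB]
    exact hmin β hβ i hi

/-- [OURS] **Z-leastness passes to the `f`-chart** of the mixed centre `J = (T \ F) ∪ {f}`: the Z-members all
shift by the same amount at the new index. -/
theorem isZLeast_chart (hs : s.WF) (hN : N ∉ s.B) (hf : f ∈ F) (hfT : f ∈ T) (hT : T ⊆ s.B) {ζ : ℕ →₀ ℕ}
    (hζ : IsZLeast s F T ζ) :
    IsZLeast (move s (insert f (T \ F)) N 0) (insert N F) (insert N (T.erase f)) (moveExp (insert f (T \ F)) N 0 ζ) := by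
  classical
  refine ⟨?_, fun μ' hμ' g hg => ?_⟩
  · rw [Z_chart hN hf hT]
    exact Finset.mem_image_of_mem _ hζ.1
  · rw [Z_chart hN hf hT] at hμ'
    obtain ⟨μ, hμ, rfl⟩ := Finset.mem_image.mp hμ'
    rw [chart_inter_eq, Finset.mem_insert] at hg
    rcases hg with rfl | hg
    · -- the new index: the weights on `J = insert f (T \ F)` are `ζ f + |ζ_{T\F}|` resp. `μ f + |μ_{T\F}|`
      rw [moveExp_apply_new hs hN (mem_A_of_mem_Z hζ.1), moveExp_apply_new hs hN (mem_A_of_mem_Z hμ), weight,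
        weight, Finset.sum_insert (fun h => (Finset.mem_sdiff.mp h).2 hf),
        Finset.sum_insert (fun h => (Finset.mem_sdiff.mp h).2 hf)]
      have hw : ∑ x ∈ T \ F, ζ x = ∑ x ∈ T \ F, μ x := weight_eq_of_mem_Z hζ.1 hμ
      rw [hw]
      exact Nat.add_le_add_right (hζ.2 μ hμ f (Finset.mem_inter.mpr ⟨hfT, hf⟩)) _
    · have hg' := Finset.mem_erase.mp hg
      have hgB : g ∈ s.B := hT (Finset.mem_inter.mp hg'.2).1
      rw [moveExp_apply_old hN hgB, moveExp_apply_old hN hgB]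
      exact hζ.2 μ hμ g hg'.2

/-- [OURS] The term of the defect at the NEW index after the mixed move, for a Z-member `ζ` and a non-Z
generator `α`: it is at most the old term at `f`, and strictly less when that term was positive — because
`α` carries strictly more weight than `ζ` on the `F`-free part `T \ F` (`weight_lt_of_not_mem_Z`). -/
theorem chart_term_le (hs : s.WF) (hN : N ∉ s.B) (hf : f ∈ F) {ζ α : ℕ →₀ ℕ} (hζ : ζ ∈ Z s F T) (hα : α ∈ s.A) (hαZ : α ∉ Z s F T) :
    moveExp (insert f (T \ F)) N 0 ζ N - moveExp (insert f (T \ F)) N 0 α N ≤ ζ f - α f ∧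
      (α f < ζ f → moveExp (insert f (T \ F)) N 0 ζ N - moveExp (insert f (T \ F)) N 0 α N < ζ f - α f) := by
  classical
  have hfnot : f ∉ T \ F := fun h => (Finset.mem_sdiff.mp h).2 hf
  rw [moveExp_apply_new hs hN (mem_A_of_mem_Z hζ), moveExp_apply_new hs hN hα, weight, weight,
    Finset.sum_insert hfnot, Finset.sum_insert hfnot]
  have hlt : ∑ x ∈ T \ F, ζ x < ∑ x ∈ T \ F, α x := weight_lt_of_not_mem_Z hζ hα hαZ
  constructor
  · omega
  · intro h; omega

/-- [OURS] **The defect does not increase on the `f`-chart of the mixed centre `J = (T \ F) ∪ {f}`**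
(ROUTE-F §2(c)): old free indices keep their terms, the new index carries a term bounded by the old term at
`f`. -/
theorem defect_chart_le (hs : s.WF) (hN : N ∉ s.B) (hf : f ∈ F) (hfT : f ∈ T) (hT : T ⊆ s.B) {ζ : ℕ →₀ ℕ}
    (hζ : ζ ∈ Z s F T) :
    defect (move s (insert f (T \ F)) N 0) (insert N F) (insert N (T.erase f)) (moveExp (insert f (T \ F)) N 0 ζ) ≤
      defect s F T ζ := by
  classical
  set J := insert f (T \ F) with hJ
  set m := moveExp J N 0 with hm
  have hNT : N ∉ T := fun h => hN (hT h)
  have hfTF : f ∈ T ∩ F := Finset.mem_inter.mpr ⟨hfT, hf⟩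
  -- the index sets
  have hsd : (move s J N 0).A \ Z (move s J N 0) (insert N F) (insert N (T.erase f)) = (s.A \ Z s F T).image m := by
    rw [Z_chart hN hf hT]
    show s.A.image m \ (Z s F T).image m = _
    rw [Finset.image_sdiff_of_injOn (moveExp_injOn hs hN) (fun α hα => mem_A_of_mem_Z hα)]
  rw [defect, defect, hsd, Finset.sum_image fun α hα β hβ h =>
    moveExp_injOn hs hN (Finset.mem_sdiff.mp hα).1 (Finset.mem_sdiff.mp hβ).1 h, chart_inter_eq]
  refine Finset.sum_le_sum fun α hα => ?_
  obtain ⟨hαA, hαZ⟩ := Finset.mem_sdiff.mp hα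
  rw [Finset.sum_insert (fun h => hNT (Finset.mem_inter.mp (Finset.mem_erase.mp h).2).1),
    ← Finset.add_sum_erase _ _ hfTF]
  refine Nat.add_le_add (chart_term_le hs hN hf hζ hαA hαZ).1 (le_of_eq (Finset.sum_congr rfl fun g hg => ?_))
  have hgB : g ∈ s.B := hT (Finset.mem_inter.mp (Finset.mem_erase.mp hg).2).1
  rw [hm, moveExp_apply_old hN hgB, moveExp_apply_old hN hgB]

/-- [OURS] **… and strictly decreases when the Z-member beats some non-Z generator at `f`** (the violation chosen
by Phase B of ROUTE-F). -/
theorem defect_chart_lt (hs : s.WF) (hN : N ∉ s.B) (hf : f ∈ F) (hfT : f ∈ T) (hT : T ⊆ s.B) {ζ : ℕ →₀ ℕ}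
    (hζ : ζ ∈ Z s F T)
    {α₀ : ℕ →₀ ℕ} (hα₀ : α₀ ∈ s.A) (hα₀Z : α₀ ∉ Z s F T) (hviol : α₀ f < ζ f) :
    defect (move s (insert f (T \ F)) N 0) (insert N F) (insert N (T.erase f)) (moveExp (insert f (T \ F)) N 0 ζ) <
      defect s F T ζ := by
  classical
  set J := insert f (T \ F) with hJ
  set m := moveExp J N 0 with hm
  have hNT : N ∉ T := fun h => hN (hT h)
  have hfTF : f ∈ T ∩ F := Finset.mem_inter.mpr ⟨hfT, hf⟩
  have hsd : (move s J N 0).A \ Z (move s J N 0) (insert N F) (insert N (T.erase f)) = (s.A \ Z s F T).image m := by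
    rw [Z_chart hN hf hT]
    show s.A.image m \ (Z s F T).image m = _
    rw [Finset.image_sdiff_of_injOn (moveExp_injOn hs hN) (fun α hα => mem_A_of_mem_Z hα)]
  rw [defect, defect, hsd, Finset.sum_image fun α hα β hβ h =>
    moveExp_injOn hs hN (Finset.mem_sdiff.mp hα).1 (Finset.mem_sdiff.mp hβ).1 h, chart_inter_eq]
  refine Finset.sum_lt_sum (fun α hα => ?_) ⟨α₀, Finset.mem_sdiff.mpr ⟨hα₀, hα₀Z⟩, ?_⟩
  · obtain ⟨hαA, hαZ⟩ := Finset.mem_sdiff.mp hα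
    rw [Finset.sum_insert (fun h => hNT (Finset.mem_inter.mp (Finset.mem_erase.mp h).2).1),
      ← Finset.add_sum_erase _ _ hfTF]
    refine Nat.add_le_add (chart_term_le hs hN hf hζ hαA hαZ).1 (le_of_eq (Finset.sum_congr rfl fun g hg => ?_))
    have hgB : g ∈ s.B := hT (Finset.mem_inter.mp (Finset.mem_erase.mp hg).2).1
    rw [hm, moveExp_apply_old hN hgB, moveExp_apply_old hN hgB]
  · rw [Finset.sum_insert (fun h => hNT (Finset.mem_inter.mp (Finset.mem_erase.mp h).2).1),
      ← Finset.add_sum_erase _ _ hfTF]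
    refine Nat.add_lt_add_of_lt_of_le ((chart_term_le hs hN hf hζ hα₀ hα₀Z).2 hviol)
      (le_of_eq (Finset.sum_congr rfl fun g hg => ?_))
    have hgB : g ∈ s.B := hT (Finset.mem_inter.mp (Finset.mem_erase.mp hg).2).1
    rw [hm, moveExp_apply_old hN hgB, moveExp_apply_old hN hgB]

end MixedChart

end PolyhedraGame

end Summit.ResolutionOfSingularities.ResolutionOfSingularities.Theorems
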